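import Literature.Analysis.OperatorTheory.LpDilation
import Mathlib.Analysis.SpecialFunctions.Exp
import HarnessLib

/-!
# The similarity heat semigroup on the Fourier side: an explicit weighted dilation semigroup
  on `L^p` (Jia–Šverák 2015, Lemma 2.1; Albritton–Brué–Colombo 2022, §2 — the free part of `L_ss`)

Analysis/OperatorTheory support file (three definitions with bodies, everything proved, no named
facts). In similarity variables `ξ = x/√t`, `τ = log t` the heat equation becomes
`∂_τ U = (Δ + ½ ξ·∇ + ½) U =: 𝓛 U`, and `e^{τ𝓛} U₀ (ξ) = e^{τ/2} (e^{(e^τ − 1)Δ} U₀)(e^{τ/2} ξ)`.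
On the Fourier side (Mathlib's convention `𝓕f(k) = ∫ e^{−2πi⟨x,k⟩} f(x) dx`, so
`(f(b·))^ = b^{−d} f̂(·/b)`, `(e^{sΔ}f)^ = e^{−4π²s‖k‖²} f̂`) this is the **weighted dilation**

  `(M_τ h)(k) = e^{(1−d)τ/2} · exp(−4π²(1 − e^{−τ})‖k‖²) · h(e^{−τ/2} k)`,   `d = dim V`,

which we take as the DEFINITION here (`fourierSimilarityHeat τ`), on `L^p(V; F)` for any
`1 ≤ p < ∞` — no heat-kernel facts are needed:

* `lpMul w … : Lp F p →L[ℂ] Lp F p` (**definition**): multiplication by a bounded measurable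
  scalar function, `‖lpMul w f‖ ≤ C ‖f‖`;
* `similarityWeight τ k = e^{(1−d)τ/2} exp(−4π²(1−e^{−τ})‖k‖²)` (**definition**), bounded by
  `e^{(1−d)τ/2}` for `τ ≥ 0`, and the **cocycle identity**
  `similarityWeight τ k * similarityWeight σ (e^{−τ/2} k) = similarityWeight (τ + σ) k`;
* `fourierSimilarityHeat τ := lpMul (similarityWeight τ) ∘ lpDilation (e^{−τ/2})`
  (**definition**), `fourierSimilarityHeat_coeFn`, the **semigroup law**
  `fourierSimilarityHeat (τ + σ) = fourierSimilarityHeat τ * fourierSimilarityHeat σ`,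
  `fourierSimilarityHeat_zero = 1`, and the **bound**
  `‖fourierSimilarityHeat τ f‖ ≤ e^{(1−d)τ/2} |e^{dτ/2}|^{1/p} ‖f‖` (for `p = 2`, `d = 3`:
  `e^{−τ/4}`, Jia–Šverák's growth bound giving `σ(𝓛) ⊆ {Re λ ≤ −¼}` on `L²(ℝ³)`).

Strong continuity in `τ` and the conjugation by the `L²` Fourier transform
(`MeasureTheory.Lp.fourierTransformₗᵢ`) — making it a `C0Semigroup` to which the Laplace bridge
`SemigroupLaplaceResolvent*.lean` applies — are the next steps.

## References

* H. Jia, V. Šverák, J. Funct. Anal. 268 (2015), §2, Lemma 2.1 and the formula for `e^{τ𝓛}`.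
  [JiaSverak2015]
* D. Albritton, E. Brué, M. Colombo, Ann. of Math. 196 (2022), arXiv:2112.03116, §2.2–§2.3
  (`L_ss = −½(1 + ξ·∇) − Δ + …`; "`e^{τ L_ss}` … as proven in [JŠ15]"). [AlbrittonBrueColombo2022AnnMath]
* Th. Gallay, C. E. Wayne, *Invariant manifolds and the long-time asymptotics of the
  Navier–Stokes and vorticity equations on ℝ²*, Arch. Ration. Mech. Anal. 163 (2002), App. A
  (explicit formula for the semigroup in similarity variables). [folklore]
-/

noncomputable section

open MeasureTheory Filter Topology Real
open scoped ENNReal NNReal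

namespace Literature.Analysis.OperatorTheory

variable {V : Type*} [NormedAddCommGroup V] [InnerProductSpace ℝ V] [FiniteDimensional ℝ V]
  [MeasurableSpace V] [BorelSpace V]
variable {F : Type*} [NormedAddCommGroup F] [NormedSpace ℂ F]
variable {p : ℝ≥0∞}

/-! ### Multiplication by a bounded measurable scalar function -/

/-- `w • g ∈ L^p` for `g ∈ L^p` and `w` measurable with `‖w‖ ≤ C`. [folklore] -/
theorem memLp_smul_of_bound {w : V → ℂ} (hw : Measurable w) {C : ℝ} (hC : ∀ k, ‖w k‖ ≤ C)
    {g : V → F} (hg : MemLp g p (volume : Measure V)) :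
    MemLp (fun k => w k • g k) p (volume : Measure V) := by
  refine MemLp.of_le_mul (c := C) hg (hw.aestronglyMeasurable.smul hg.aestronglyMeasurable) ?_
  exact Eventually.of_forall fun k => by
    rw [norm_smul]; exact mul_le_mul_of_nonneg_right (hC k) (norm_nonneg _)

/-- `‖w • g‖_p ≤ max C 0 · ‖g‖_p`. [folklore] -/
theorem eLpNorm_smul_le_of_bound {w : V → ℂ} {C : ℝ} (hC : ∀ k, ‖w k‖ ≤ C) (g : V → F) :
    eLpNorm (fun k => w k • g k) p (volume : Measure V) ≤
      ENNReal.ofReal (max C 0) * eLpNorm g p volume :=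
  eLpNorm_le_mul_eLpNorm_of_ae_le_mul (Eventually.of_forall fun k => by
    rw [norm_smul]
    exact mul_le_mul_of_nonneg_right ((hC k).trans (le_max_left _ _)) (norm_nonneg _)) p

variable [Fact (1 ≤ p)]

/-- **Multiplication by a bounded measurable scalar function on `L^p(V; F)`** as a bounded
operator. [folklore] -/
def lpMul (w : V → ℂ) (hw : Measurable w) (C : ℝ) (hC : ∀ k, ‖w k‖ ≤ C) :
    Lp F p (volume : Measure V) →L[ℂ] Lp F p (volume : Measure V) :=
  LinearMap.mkContinuous
    { toFun := fun f => (memLp_smul_of_bound hw hC (Lp.memLp f)).toLp _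
      map_add' := fun f g => by
        apply Lp.ext
        refine (MemLp.coeFn_toLp _).trans ?_
        refine EventuallyEq.trans ?_ (Lp.coeFn_add _ _).symm
        filter_upwards [Lp.coeFn_add f g,
          MemLp.coeFn_toLp (memLp_smul_of_bound hw hC (Lp.memLp f)),
          MemLp.coeFn_toLp (memLp_smul_of_bound hw hC (Lp.memLp g))] with k hk hx hy
        simp only [Pi.add_apply, hk, hx, hy, smul_add]
      map_smul' := fun c f => by
        apply Lp.ext
        refine (MemLp.coeFn_toLp _).trans ?_
        refine EventuallyEq.trans ?_ (Lp.coeFn_smul _ _).symm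
        filter_upwards [Lp.coeFn_smul c f,
          MemLp.coeFn_toLp (memLp_smul_of_bound hw hC (Lp.memLp f))] with k hk hx
        simp only [Pi.smul_apply, hk, hx, RingHom.id_apply, smul_comm c] }
    (max C 0)
    (fun f => by
      simp only [LinearMap.coe_mk, AddHom.coe_mk, Lp.norm_toLp]
      rw [Lp.norm_def]
      have hfin : eLpNorm (f : V → F) p volume ≠ ∞ := (Lp.memLp f).eLpNorm_ne_top
      have h := ENNReal.toReal_mono (ENNReal.mul_ne_top ENNReal.ofReal_ne_top hfin)
        (eLpNorm_smul_le_of_bound (p := p) hC (f : V → F))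
      rwa [ENNReal.toReal_mul, ENNReal.toReal_ofReal (le_max_right _ _)] at h)

/-- `lpMul w f = w • f` almost everywhere. [folklore] -/
theorem lpMul_coeFn {w : V → ℂ} (hw : Measurable w) {C : ℝ} (hC : ∀ k, ‖w k‖ ≤ C)
    (f : Lp F p (volume : Measure V)) :
    (lpMul w hw C hC f : V → F) =ᵐ[(volume : Measure V)] fun k => w k • f k :=
  MemLp.coeFn_toLp (memLp_smul_of_bound hw hC (Lp.memLp f))

/-- `‖lpMul w f‖ ≤ max C 0 · ‖f‖`. [folklore] -/
theorem norm_lpMul_apply_le {w : V → ℂ} (hw : Measurable w) {C : ℝ} (hC : ∀ k, ‖w k‖ ≤ C)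
    (f : Lp F p (volume : Measure V)) : ‖lpMul w hw C hC f‖ ≤ max C 0 * ‖f‖ := by
  rw [Lp.norm_def, Lp.norm_def, eLpNorm_congr_ae (lpMul_coeFn hw hC f)]
  have hfin : eLpNorm (f : V → F) p volume ≠ ∞ := (Lp.memLp f).eLpNorm_ne_top
  have h := ENNReal.toReal_mono (ENNReal.mul_ne_top ENNReal.ofReal_ne_top hfin)
    (eLpNorm_smul_le_of_bound (p := p) hC (f : V → F))
  rwa [ENNReal.toReal_mul, ENNReal.toReal_ofReal (le_max_right _ _)] at h

/-- `‖lpMul w‖ ≤ max C 0`. [folklore] -/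
theorem norm_lpMul_le {w : V → ℂ} (hw : Measurable w) {C : ℝ} (hC : ∀ k, ‖w k‖ ≤ C) :
    ‖(lpMul w hw C hC : Lp F p (volume : Measure V) →L[ℂ] Lp F p (volume : Measure V))‖ ≤
      max C 0 :=
  ContinuousLinearMap.opNorm_le_bound _ (le_max_right _ _) (norm_lpMul_apply_le hw hC)

/-! ### The weight and its cocycle identity -/

/-- The Fourier-side weight of the similarity heat semigroup:
`w_τ(k) = e^{(1−d)τ/2} exp(−4π²(1 − e^{−τ})‖k‖²)`. [cite: JiaSverak2015, §2 (formula for e^{τ𝓛})] -/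
def similarityWeight (τ : ℝ) (k : V) : ℝ :=
  Real.exp ((1 - Module.finrank ℝ V) * τ / 2) * Real.exp (-(4 * π ^ 2 * (1 - Real.exp (-τ)) * ‖k‖ ^ 2))

omit [FiniteDimensional ℝ V] [MeasurableSpace V] [BorelSpace V] [Fact (1 ≤ p)] in
/-- The weight is continuous in `k`. [folklore] -/
theorem continuous_similarityWeight (τ : ℝ) : Continuous (similarityWeight (V := V) τ) := by
  unfold similarityWeight
  fun_prop

omit [FiniteDimensional ℝ V] [MeasurableSpace V] [BorelSpace V] [Fact (1 ≤ p)] in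
/-- `0 < w_τ(k)`. [folklore] -/
theorem similarityWeight_pos (τ : ℝ) (k : V) : 0 < similarityWeight τ k :=
  mul_pos (Real.exp_pos _) (Real.exp_pos _)

omit [FiniteDimensional ℝ V] [MeasurableSpace V] [BorelSpace V] [Fact (1 ≤ p)] in
/-- `w_τ(k) ≤ e^{(1−d)τ/2}` for `τ ≥ 0` (the Gaussian factor is `≤ 1`). [folklore] -/
theorem similarityWeight_le {τ : ℝ} (hτ : 0 ≤ τ) (k : V) :
    similarityWeight τ k ≤ Real.exp ((1 - Module.finrank ℝ V) * τ / 2) := by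
  unfold similarityWeight
  refine mul_le_of_le_one_right (Real.exp_pos _).le (Real.exp_le_one_iff.2 ?_)
  have h1 : 0 ≤ 1 - Real.exp (-τ) := by
    rw [sub_nonneg, Real.exp_le_one_iff]; linarith
  have : 0 ≤ 4 * π ^ 2 * (1 - Real.exp (-τ)) * ‖k‖ ^ 2 := by positivity
  linarith

omit [FiniteDimensional ℝ V] [MeasurableSpace V] [BorelSpace V] [Fact (1 ≤ p)] in
/-- **Cocycle identity** `w_τ(k) · w_σ(e^{−τ/2} k) = w_{τ+σ}(k)` (behind the semigroup law;
the exponent identity `(1 − e^{−τ}) + e^{−τ}(1 − e^{−σ}) = 1 − e^{−(τ+σ)}`). [cite: JiaSverak2015, §2] -/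
theorem similarityWeight_mul (τ σ : ℝ) (k : V) :
    similarityWeight τ k * similarityWeight σ (Real.exp (-τ / 2) • k) =
      similarityWeight (τ + σ) k := by
  unfold similarityWeight
  rw [norm_smul, Real.norm_eq_abs, abs_of_pos (Real.exp_pos _), mul_pow, ← Real.exp_nat_mul]
  have h2 : Real.exp ((2 : ℕ) * (-τ / 2)) = Real.exp (-τ) := by
    congr 1; push_cast; ring
  rw [h2]
  rw [mul_mul_mul_comm, ← Real.exp_add, ← Real.exp_add]
  congr 1
  · congr 1; ring
  · congr 1
    rw [show Real.exp (-(τ + σ)) = Real.exp (-τ) * Real.exp (-σ) by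
      rw [← Real.exp_add]; ring_nf]
    ring

/-! ### The semigroup -/

omit [FiniteDimensional ℝ V] [Fact (1 ≤ p)] in
/-- Measurability of the complexified weight. [folklore] -/
theorem measurable_similarityWeight_ofReal (τ : ℝ) :
    Measurable fun k : V => (similarityWeight τ k : ℂ) :=
  Complex.measurable_ofReal.comp (continuous_similarityWeight τ).measurable

omit [FiniteDimensional ℝ V] [MeasurableSpace V] [BorelSpace V] [Fact (1 ≤ p)] in
/-- The complexified weight is bounded by `e^{(1−d)τ/2}` for `τ ≥ 0`. [folklore] -/
theorem norm_similarityWeight_ofReal_le (τ : ℝ≥0) (k : V) :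
    ‖(similarityWeight (τ : ℝ) k : ℂ)‖ ≤ Real.exp ((1 - Module.finrank ℝ V) * (τ : ℝ) / 2) := by
  rw [Complex.norm_real, Real.norm_eq_abs, abs_of_pos (similarityWeight_pos _ _)]
  exact similarityWeight_le τ.coe_nonneg k

/-- **The similarity heat semigroup on the Fourier side**, `(M_τ h)(k) = w_τ(k) h(e^{−τ/2} k)`,
`τ ≥ 0`, as a bounded operator on `L^p(V; F)` (`1 ≤ p < ∞`). [cite: JiaSverak2015, §2 Lemma 2.1] -/
def fourierSimilarityHeat (hp : p ≠ ∞) (τ : ℝ≥0) :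
    Lp F p (volume : Measure V) →L[ℂ] Lp F p (volume : Measure V) :=
  lpMul (fun k => (similarityWeight (τ : ℝ) k : ℂ)) (measurable_similarityWeight_ofReal τ)
      (Real.exp ((1 - Module.finrank ℝ V) * (τ : ℝ) / 2)) (norm_similarityWeight_ofReal_le τ) *
    lpDilation (Real.exp (-(τ : ℝ) / 2)) (Real.exp_pos _).ne' hp

/-- `M_τ f = w_τ • f(e^{−τ/2} ·)` almost everywhere. [cite: JiaSverak2015, §2 Lemma 2.1] -/
theorem fourierSimilarityHeat_coeFn (hp : p ≠ ∞) (τ : ℝ≥0) (f : Lp F p (volume : Measure V)) :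
    (fourierSimilarityHeat hp τ f : V → F) =ᵐ[(volume : Measure V)]
      fun k => (similarityWeight (τ : ℝ) k : ℂ) • f (Real.exp (-(τ : ℝ) / 2) • k) := by
  rw [fourierSimilarityHeat, mul_apply_eq_comp]
  refine (lpMul_coeFn _ _ _).trans ?_
  filter_upwards [lpDilation_coeFn (F := F) (Real.exp_pos (-(τ : ℝ) / 2)).ne' hp f] with k hk
  rw [hk]

/-- **The growth bound** `‖M_τ f‖ ≤ e^{(1−d)τ/2} · |e^{dτ/2}|^{1/p} ‖f‖` (for `p = 2`, `d = 3`: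
`e^{−τ/4} ‖f‖`). [cite: JiaSverak2015, §2 Lemma 2.1] -/
theorem norm_fourierSimilarityHeat_apply_le (hp : p ≠ ∞) (τ : ℝ≥0)
    (f : Lp F p (volume : Measure V)) :
    ‖fourierSimilarityHeat hp τ f‖ ≤ Real.exp ((1 - Module.finrank ℝ V) * (τ : ℝ) / 2) *
      ((ENNReal.ofReal |((Real.exp (-(τ : ℝ) / 2)) ^ Module.finrank ℝ V)⁻¹| ^
        (1 / p).toReal).toReal * ‖f‖) := by
  rw [fourierSimilarityHeat, mul_apply_eq_comp]
  refine (norm_lpMul_apply_le _ _ _).trans ?_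
  rw [max_eq_left (Real.exp_pos _).le, norm_lpDilation_apply]

/-- **`M_0 = 1`.** [cite: JiaSverak2015, §2 Lemma 2.1] -/
theorem fourierSimilarityHeat_zero (hp : p ≠ ∞) :
    (fourierSimilarityHeat hp 0 : Lp F p (volume : Measure V) →L[ℂ] Lp F p (volume : Measure V)) =
      1 := by
  ext1 f
  apply Lp.ext
  refine (fourierSimilarityHeat_coeFn hp 0 f).trans (Eventually.of_forall fun k => ?_)
  simp [similarityWeight]

/-- **The semigroup law `M_{τ+σ} = M_τ M_σ`** (cocycle identity of the weight and
`e^{−σ/2} e^{−τ/2} = e^{−(τ+σ)/2}`). [cite: JiaSverak2015, §2 Lemma 2.1] -/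
theorem fourierSimilarityHeat_add (hp : p ≠ ∞) (τ σ : ℝ≥0) :
    (fourierSimilarityHeat hp (τ + σ) :
        Lp F p (volume : Measure V) →L[ℂ] Lp F p (volume : Measure V)) =
      fourierSimilarityHeat hp τ * fourierSimilarityHeat hp σ := by
  ext1 f
  apply Lp.ext
  rw [mul_apply_eq_comp]
  refine (fourierSimilarityHeat_coeFn hp (τ + σ) f).trans ?_
  refine EventuallyEq.trans ?_ (fourierSimilarityHeat_coeFn hp τ _).symm
  filter_upwards [ae_eq_comp_smul (fourierSimilarityHeat_coeFn hp σ f)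
    (Real.exp_pos (-(τ : ℝ) / 2)).ne'] with k hk
  rw [hk, smul_smul, smul_smul, ← Complex.ofReal_mul, similarityWeight_mul, ← Real.exp_add,
    NNReal.coe_add]
  congr 2
  ring

/-! ### The growth bound in closed form -/

omit [FiniteDimensional ℝ V] [MeasurableSpace V] [BorelSpace V] in
/-- The `L^p` dilation factor of `x ↦ e^{−τ/2} x` in closed form: `|(e^{−τ/2})^{−d}|^{1/p} = e^{dτ/(2p)}`.
[folklore] -/
theorem dilationFactor_eq (hp : p ≠ ∞) (τ : ℝ) :
    (ENNReal.ofReal |((Real.exp (-τ / 2)) ^ Module.finrank ℝ V)⁻¹| ^ (1 / p).toReal).toReal =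
      Real.exp (Module.finrank ℝ V * τ / (2 * p.toReal)) := by
  have hpos : 0 < ((Real.exp (-τ / 2)) ^ Module.finrank ℝ V)⁻¹ := by positivity
  rw [abs_of_pos hpos, ← ENNReal.toReal_rpow, ENNReal.toReal_ofReal hpos.le, ← Real.exp_nat_mul,
    ← Real.exp_neg, ← Real.exp_mul, ENNReal.toReal_div, ENNReal.toReal_one]
  congr 1
  have hp0 : p.toReal ≠ 0 :=
    ENNReal.toReal_ne_zero.2 ⟨(zero_lt_one.trans_le (Fact.out : 1 ≤ p)).ne', hp⟩
  field_simp

/-- **The growth bound in closed form**: `‖M_τ f‖ ≤ e^{((1−d)/2 + d/(2p)) τ} ‖f‖`; for `p = 2`,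
`d = 3` the exponent is `−τ/4` (Jia–Šverák: `‖e^{τ𝓛}‖_{L² → L²} ≤ e^{−τ/4}`, whence
`σ(𝓛) ⊆ {Re λ ≤ −¼}`). [cite: JiaSverak2015, §2 Lemma 2.1] -/
theorem norm_fourierSimilarityHeat_apply_le' (hp : p ≠ ∞) (τ : ℝ≥0)
    (f : Lp F p (volume : Measure V)) :
    ‖fourierSimilarityHeat hp τ f‖ ≤
      Real.exp (((1 - Module.finrank ℝ V) / 2 + Module.finrank ℝ V / (2 * p.toReal)) * (τ : ℝ)) *
        ‖f‖ := by
  refine (norm_fourierSimilarityHeat_apply_le hp τ f).trans (le_of_eq ?_)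
  rw [dilationFactor_eq hp, ← mul_assoc, ← Real.exp_add]
  congr 2
  ring

/-- The operator-norm form `‖M_τ‖ ≤ 1 · e^{ω τ}`, `ω = (1−d)/2 + d/(2p)`, ready for the Laplace
bridge `C0Semigroup.laplaceResolvent` (growth bound `‖T(t)‖ ≤ M e^{ωt}` with `M = 1`).
[cite: JiaSverak2015, §2 Lemma 2.1] -/
theorem norm_fourierSimilarityHeat_le (hp : p ≠ ∞) (τ : ℝ≥0) :
    ‖(fourierSimilarityHeat hp τ : Lp F p (volume : Measure V) →L[ℂ] Lp F p (volume : Measure V))‖ ≤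
      1 * Real.exp (((1 - Module.finrank ℝ V) / 2 + Module.finrank ℝ V / (2 * p.toReal)) * (τ : ℝ)) := by
  rw [one_mul]
  exact ContinuousLinearMap.opNorm_le_bound _ (Real.exp_pos _).le
    (norm_fourierSimilarityHeat_apply_le' hp τ)

end Literature.Analysis.OperatorTheory
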